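import Summits.QuantumFields.YangMills.Theses.UnitScaleTilt
import Summits.QuantumFields.YangMills.Theorems.UnitScaleTiltHistoryTailBudget

/-!
# Route `UnitScaleTilt` — crux K2 `HistoryTail` (stmt-QuantumFields-18916), birth v4 («R2 cut», sha16 `2dd95f606719a12c`): the registered
# stub `stub_budget` PROVED with the v4 SIGNATURE VERBATIM (support file; K2 stays open on `stub_perPlaquetteHighRaw`)

Fleet lead `ym-ust-18916-p1` (gen 0).  The route owner's ruling of 2026-08-26 ~11:17Z on this seat's finding (`FINDING-18916-alpha-idle.md`,
af2a5b6fdc02c5ee: the (α) hypothesis of the v3b stub was idle) re-cut K2's skeleton by MECHANISM (split card `CARD-18916-K2-split.md`, S0–S6):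
birth v4 registers `stub_perPlaquetteHighRaw` (the per-plaquette large-field Gibbs tail of the block-averaged fields at all high heights in
print's RAW currency `C·β^A·exp(−¼p(g)² + κ·(1 + log g⁻¹)^{2+3r₀})`, XXL) and `stub_budget` (the G-B10-02 budget: for `p₀ > 1 + 3r₀/2` the
collar cost is absorbed by half the Gaussian-in-`p(g)` small factor) and composes them with the LANDED pieces p438760
(`HistoryTailBoundedHeight.perPlaquette_of_split`) and p432346 (`HistoryTailBirthV3b.stub_tailOfPerPlaquette`) into the route decl.

THIS FILE restates `stub_budget` with the REGISTERED v4 text and proves it by this seat's landed theorem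
`HistoryTailBudget.largeFieldBudget_collar` (p439633: `exp(−¼p(g)² + κx^{2+3r₀}) ≤ C·exp(−⅛p(g)²)`, `x = 1 + log g⁻¹ ≥ 1`, via
`p(g)² = b₀²x^{2p₀}` and `κx^a ≤ ⅛b₀²x^{2p₀} + κT^{a/(2p₀−a)}` above/below the threshold `T = max 1 (8κ/b₀²)`).  NOT a proof of K2.
-/

noncomputable section

open Literature.MathematicalPhysics.QuantumFieldTheory.Balaban1983to89
open Summit.QuantumFields.YangMills.Theorems.HistoryTailBudget (largeFieldBudget_collar)

namespace Summit.QuantumFields.YangMills.Theorems.HistoryTailBirthV4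

/-- **REGISTERED STUB `stub_budget` OF K2's BIRTH v4, PROVED** (signature verbatim): for `b₀ > 0`, `r₀ ≥ 0`, `κ ≥ 0` and `p₀ > 1 + 3r₀/2`
there are `C ≥ 0`, `c > 0` with `exp(−¼p(g)² + κ(1 + log g⁻¹)^{2+3r₀}) ≤ C·exp(−c·p(g)²)` for all `0 < g ≤ 1`, `p = B10.pFun b₀ p₀` — the
G-B10-02 budget (collar cost versus the printed small factor `exp(−¼p(g)²)` of (71)), by `HistoryTailBudget.largeFieldBudget_collar`
(`c = ⅛`). [cite: Balaban1985UV3, (7) p.257 and (71) p.273] -/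
theorem stub_budget :
    ∀ (b₀ p₀ r₀ κ : ℝ), 0 < b₀ → 0 ≤ r₀ → 0 ≤ κ → 1 + 3 * r₀ / 2 < p₀ →
      ∃ C c : ℝ, 0 ≤ C ∧ 0 < c ∧ ∀ g : ℝ, 0 < g → g ≤ 1 →
        Real.exp (-(B10.pFun b₀ p₀ g ^ 2 / 4) + κ * (1 + Real.log g⁻¹) ^ (2 + 3 * r₀)) ≤
          C * Real.exp (-(c * B10.pFun b₀ p₀ g ^ 2)) :=
  fun b₀ p₀ r₀ κ hb₀ hr₀ hκ hp₀ => largeFieldBudget_collar b₀ p₀ κ r₀ hb₀ hκ hr₀ hp₀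

end Summit.QuantumFields.YangMills.Theorems.HistoryTailBirthV4

end
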